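import Summits.BirchSwinnertonDyer.BirchSwinnertonDyer.Theses.ShadowIsolation
import Literature.NumberTheory.EllipticCurves.BSDSelmerParityDokchitserProofs
import Literature.NumberTheory.EllipticCurves.LeadingTerm
import Literature.NumberTheory.EllipticCurves.PAdicBSD
import HarnessLib

/-!
# BirchSwinnertonDyer — crux `SelmerRankUB` (stmt-BirchSwinnertonDyer-0130), line `greenberg-split`,
# stub `stub_gzkSelmerCell`: the conditional discharge (literature debt, itemised)

Stub `stub_gzkSelmerCell` of line `greenberg-split` (crux `ShadowIsolation.SelmerRankUB` =
`SelmerRank.SelmerRankUB`, the upper half of `p^∞`-Selmer BSD at a big-image good ordinary prime)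
is the image-free GZK-SELMER CELL

  `∀ W elliptic, p prime, ord_{s=1} L(W,s) ≤ 1 → corank_{ℤ_p} Sel_{p^∞}(W/ℚ) ≤ ord_{s=1} L(W,s)`,

a theorem in print: Gross–Zagier 1986 + Kolyvagin 1990 with modularity (Darmon, CBMS 101 (2004),
Thm. 3.22: `ord_{s=1} L(E,s) ≤ 1 ⇒ rank E(ℚ) = ord_{s=1} L(E,s)` and `Ш(E/ℚ)` finite), combined
with Greenberg's corank identity `corank Sel_{p^∞} = rank + corank Ш[p^∞]` (Greenberg, LNM 1716
(1999), §1; tree THEOREM `WeierstrassCurve.selmerCorank_eq_mordellWeilRank_add_holds`) and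
`corank Ш[p^∞] = 0` for finite `Ш` (tree theorem `WeierstrassCurve.shaCorank_eq_zero_of_finite`);
at `ord = 0` also Kato, Astérisque 295 (2004), Cor. 14.3 (`L(E,1) ≠ 0 ⇒ Sel_{p^∞}(E/ℚ)` finite),
Heegner-free.

The tree holds Gross–Zagier–Kolyvagin only as the UNDISCHARGED named fact bsd.S17
`Literature.NumberTheory.EllipticCurves.rank_eq_analyticRank_of_analyticRank_le_one` (no
`rank_eq_analyticRank_of_analyticRank_le_one_holds`), and Kato's finiteness theorem only as the
named fact bsd.S20 `Literature.NumberTheory.EllipticCurves.kato_finite_of_L_one_ne_zero` (no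
`_holds`). So the UNCONDITIONAL stub is literature debt behind
`rank_eq_analyticRank_of_analyticRank_le_one_holds`; this file does NOT prove the stub and does
not carry its name. It records, sorry-free and CONDITIONALLY (named facts as hypotheses, never
vendored), exactly what the stub costs:

* `gzkSelmerCell_of_grossZagierKolyvagin` — the whole cell from bsd.S17, one line over the tree
  corollary `selmerCorank_eq_analyticRank_of_analyticRank_le_one`
  (`BSDSelmerParityDokchitserProofs`);
* `selmerCorank_eq_zero_of_kato` — `L(W,1) ≠ 0 ⇒ corank_{ℤ_p} Sel_{p^∞}(W/ℚ) = 0` from bsd.S20 at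
  the one pair `(W, p)` (a finite group has corank `0`, `zpCorank_eq_zero_of_finite`);
* `gzkSelmerCell_rankZero_of_kato` — the `ord = 0` sub-cell of the stub from bsd.S20 and the
  entire continuation of `L(W,s)` (needed only to turn `ord_{s=1} L(W,s) = 0` into `L(W,1) ≠ 0`,
  the proved `analyticRank_eq_zero_iff_holds`), Heegner-free.

References: Darmon, *Rational points on modular elliptic curves*, CBMS 101 (2004), Thm. 3.22 and
§3.9; Greenberg, *Iwasawa theory for elliptic curves*, LNM 1716 (1999), §1; Kato, Astérisque 295
(2004), Thm. 14.2, Cor. 14.3.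
-/

-- D-0017: single-problem summit, so `Summit.BirchSwinnertonDyer.BirchSwinnertonDyer.…` repeats a
-- namespace BY DESIGN.
set_option linter.dupNamespace false

namespace Summit.BirchSwinnertonDyer.BirchSwinnertonDyer.Theorems

open Literature.NumberTheory.EllipticCurves WeierstrassCurve

/-! ### The cell from the packaged fact bsd.S17 (Gross–Zagier–Kolyvagin) -/

/-- **GZK-Selmer cell from Gross–Zagier–Kolyvagin**: stub `stub_gzkSelmerCell` of line
greenberg-split for crux stmt-BirchSwinnertonDyer-0130, conditional on the Gross–Zagier–Kolyvagin
named fact. If `ord_{s=1} L(W,s) ≤ 1` then `corank_{ℤ_p} Sel_{p^∞}(W/ℚ) ≤ ord_{s=1} L(W,s)` for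
every prime `p`, granting bsd.S17 (`hGZK : rank_eq_analyticRank_of_analyticRank_le_one`:
`ord ≤ 1 ⇒ rank = ord ∧ Ш finite`, UNPROVED in the tree): the `≤` half of the tree corollary
`selmerCorank_eq_analyticRank_of_analyticRank_le_one` (`corank Sel_{p^∞} = rank + corank Ш[p^∞]`,
Greenberg's identity `selmerCorank_eq_mordellWeilRank_add_holds`, and `corank Ш[p^∞] = 0` for
finite `Ш`). CONDITIONAL on `hGZK`. [cite: Darmon2004, Thm. 3.22] -/
theorem gzkSelmerCell_of_grossZagierKolyvagin :
    Literature.NumberTheory.EllipticCurves.rank_eq_analyticRank_of_analyticRank_le_one →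
      ∀ (W : WeierstrassCurve ℚ) [W.IsElliptic] (p : ℕ) [Fact p.Prime],
        W.analyticRank ≤ 1 → W.selmerCorank p ≤ W.analyticRank :=
  fun hGZK W _ p _ h => (selmerCorank_eq_analyticRank_of_analyticRank_le_one hGZK W p h).le

/-! ### The `ord = 0` sub-cell from Kato's finiteness theorem bsd.S20 — no Heegner points -/

/-- **`L(W,1) ≠ 0 ⇒ corank_{ℤ_p} Sel_{p^∞}(W/ℚ) = 0`, from Kato at one pair `(W, p)`.** Granting
Kato's finiteness theorem for the elliptic `W/ℚ` at the prime `p`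
(`hK : kato_finite_of_L_one_ne_zero W p`, Kato 2004, Thm. 14.2 / Cor. 14.3: `L(E,1) ≠ 0 ⇒ E(ℚ)`,
`Ш(E/ℚ)[p^∞]` and `Sel_{p^∞}(E/ℚ)` finite; UNPROVED in the tree), `L(W,1) ≠ 0` makes
`Sel_{p^∞}(W/ℚ)` finite, and a finite group has `ℤ_p`-corank `0` (`zpCorank_eq_zero_of_finite`,
Greenberg 1999, §1; `W.selmerCorank p = zpCorank (Sel_{p^∞}(W/ℚ)) p` by definition).
CONDITIONAL on `hK`. [cite: Kato2004Asterisque, Cor. 14.3 (p. 235)] -/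
theorem selmerCorank_eq_zero_of_kato (W : WeierstrassCurve ℚ) [W.IsElliptic] (p : ℕ)
    [Fact p.Prime] (hK : Literature.NumberTheory.EllipticCurves.kato_finite_of_L_one_ne_zero W p)
    (hL : W.entireLFunction 1 ≠ 0) : W.selmerCorank p = 0 := by
  haveI : Finite (selmerGroupPInfty W p) := (hK hL).2.2
  exact zpCorank_eq_zero_of_finite (selmerGroupPInfty W p) p

/-- **The `ord = 0` sub-cell of stub `stub_gzkSelmerCell` from Kato + continuation**
(Heegner-free): for an elliptic `W/ℚ` whose `L`-function has an entire continuation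
(`hE : W.HasEntireLFunction`; modularity, Wiles / Breuil–Conrad–Diamond–Taylor 2001) and a prime
`p` at which Kato's finiteness theorem is granted (`hK : kato_finite_of_L_one_ne_zero W p`), if
`ord_{s=1} L(W,s) = 0` then `L(W,1) ≠ 0` (the proved `analyticRank_eq_zero_iff_holds`; the
continuation is needed — in the tree's junk branch `ord = 0` but `L(W,1) = 0`), hence
`corank_{ℤ_p} Sel_{p^∞}(W/ℚ) = 0 ≤ ord_{s=1} L(W,s)` (`selmerCorank_eq_zero_of_kato`).
CONDITIONAL on `hK`, `hE`. [cite: Kato2004Asterisque, Cor. 14.3 (p. 235)] -/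
theorem gzkSelmerCell_rankZero_of_kato (W : WeierstrassCurve ℚ) [W.IsElliptic] (p : ℕ)
    [Fact p.Prime] (hK : Literature.NumberTheory.EllipticCurves.kato_finite_of_L_one_ne_zero W p)
    (hE : W.HasEntireLFunction) (h0 : W.analyticRank = 0) :
    W.selmerCorank p ≤ W.analyticRank := by
  rw [selmerCorank_eq_zero_of_kato W p hK ((W.analyticRank_eq_zero_iff_holds hE).mp h0)]
  exact Nat.zero_le _

end Summit.BirchSwinnertonDyer.BirchSwinnertonDyer.Theorems
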